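import Summits.Ventures.WeilGRH.UniformConductorFloorCoprimeData57Log9
import HarnessLib

/-!
# GRH arm (rh-explicit, venture WeilGRH): the kernel check of the EVEN level-`21` joint cell certificate `certEvenDvd21Log9` (t = log 3)

Cell `rh-explicit`, WEIL TRACK — GRH ARM (weil-grh-1, gen9 «divisibility floors at log 3, levels 5/7/10/21»).  `JointCert.checkFrame`
and `checkCells` of the even certificate `certEvenDvd21Log9` (`UniformConductorFloorCoprimeData57Log9.lean`), by `decide +kernel` (integer arithmetic
only; one certificate per file; `352` cells).  Consumed by `UniformConductorFloorCoprimeFloors57Log9.lean`.  No definitions; no named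
facts; standard axioms. [folklore]
-/

namespace Summit.Ventures.WeilGRH

namespace UniformFloor

set_option maxHeartbeats 0 in
set_option maxRecDepth 100000 in
/-- The frame of `certEvenDvd21Log9` checks (shape, `φ` bounds, shifts, exact slab masses, exact constant, `e^{2t} ≤ 10`). [folklore] -/
theorem certEvenDvd21Log9_checkFrame : certEvenDvd21Log9.checkFrame = true := by
  decide +kernel

set_option maxHeartbeats 0 in
set_option maxRecDepth 100000 in
/-- All `352` cell inequalities of `certEvenDvd21Log9` (the zipper `JointCert.checkCells`). [folklore] -/
theorem certEvenDvd21Log9_checkCells : certEvenDvd21Log9.checkCells = true := by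
  decide +kernel

end UniformFloor

end Summit.Ventures.WeilGRH
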